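import Literature.MathematicalPhysics.QuantumFieldTheory.Balaban1983to89.B6SectADomainsV1
import Literature.MathematicalPhysics.QuantumFieldTheory.Balaban1983to89.B5AveragingOnto
import Literature.MathematicalPhysics.QuantumFieldTheory.BalabanImbrieJaffe1984to88.BIJ85CurlQsstar

/-!
# `Balaban1983to89.B6SectAOntoV1` — T. Bałaban, *Propagators and renormalization transformations for lattice gauge
# theories. II*, Commun. Math. Phys. **96** (1984) 223–250 [Balaban1984PropagatorsII], Sect. A pp. 224–228 ON THE V1
# MULTI-LEVEL TORUS CALCULUS: the multi-scale constraint maps `Q′ : λ ↦ (Q′_jλ↾Λ_j)_j` and `Q : A ↦ (Q_jA↾Λ_j)_j` of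
# (2.6)/(2.7)/(2.14)/(2.20) map ONTO the configurations on `𝔅 = ⋃_j Λ_j` — the independence of the multi-scale
# constraints, i.e. the fact used on p. 225 and p. 228 that `Q′G′²Q′*` and `QGQ*` *"are positive operators, hence
# (Q′G′²Q′*)⁻¹ is well defined"*, *"QGQ* is positive also and an inverse is a well-defined and positive operator"* (for a
# positive `G′`, `G` this is exactly the injectivity of `Q′*`, `Q*`, i.e. the surjectivity of `Q′`, `Q` proved here)

statement-level skeleton of published theorems with citation tags; proofs where landed; nothing here is a claim about the
Yang–Mills mass gap

PDF held: `paper:balaban1984-cmp96-propagators-rt-ii` (journal page = PDF page + 222); pp. 224–228 read AS IMAGES on the ×2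
renders `run/shared/lean/pub/pub-balaban/b2b-balaban-ref1/pages/1984-cmp96-propagators-rt-II/…-p002…p006-x2.png` (this seat).

CITATION HEADER (lean-in-tree rule).  Cell `lit-balaban` (HOME `run/shared/lean/pub/lit-balaban/`), PHASE-2 proof seat **p21**
(gen 5), B6 fold owner r03, referee ref-4; support file of r03's ranked Phase-2 target P2 (files `…B6SectADomainsV1` (data,
Lemmas S/V), `…B6SectAZeroModesV1` (kernel of Δ_a), `…B6SectAVectorModelV1` (the Hilbert-space model)).  WHAT IS REPRODUCED:
the well-definedness inputs of SKELETON rows **B6.Eq2.17** (p. 225: `(Q′G′²Q′*)⁻¹`) and **B6.Eq2.35** (p. 228: `(QGQ*)⁻¹`) on the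
concrete multi-level lattice.  Inputs BY NAME: p11's right inverses of the one-level averages `…B5AveragingOnto.bondLift`
(`bondAvg_bondLift`), p08's block-constant pull-back `…BIJ85GaugeFunction5113.pull` (`siteAvgIter_pull`), p27's
`…BIJ85CurlQsstar.blockOf_shift_blockSite` (the far face of a block), p39's blocks of order `k` `…B5Eq118OneStroke`, file 1's
(2.4)-disjointness `lamSite_iterBlockOf_unique` and nesting lemmas.

PRINT (pp. 225, 228, verbatim).  p. 225: *"The operator G′ = Δ′_a⁻¹ is a well defined, positive operator … This implies that
G′² and Q′G′²Q′* are positive operators, hence (Q′G′²Q′*)⁻¹ is well defined and positive also."*; p. 228: *"The operator G is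
positive, hence QGQ* is positive also and an inverse is a well-defined and positive operator. We get ω = (QGQ*)⁻¹B, and from
(2.22) we obtain finally A = HB = GQ*(QGQ*)⁻¹B. (2.35)"*; the constraints (2.6) *"A = B₀ on Λ₀, Q_jA = B_j on Λ_j"* and
(2.7) *"λ = 0 on Λ₀, Q′_jλ = 0 on Λ_j"*, the sets `Λ_j` of sites and of bonds (2.3) with the p. 224 convention (file 1).

WHAT IS PROVED (0 sorry, 0 new named facts; axioms standard; every nested family `D : Domains P`, real fields).
§1 `Q′` ONTO: for every family of targets `t_j` on the `Λ_j` (sites) there is `λ` on `T_η` with `Q′_jλ = t_j` on `Λ_j` for all `j`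
(`exists_siteAvgIter_eq_on_lamSite`; `λ = Σ_j` block-constant lifts, cross terms vanish by the disjointness (2.4)).  §2 the
`k`-fold far-face lift `liftIter` (iterate of p11's `bondLift`): a right inverse of `Q_k` (`bondAvgIter_liftIter`) supported on
fine bonds CROSSING the faces of the blocks of order `k` under the support of the lifted field (`liftIter_support`).  §3 `Q` ONTO:
for every family `B_j` on the `Λ_j` (bonds) there is `A` on `T_η` with `Q_jA = B_j` on `Λ_j` for all `j` (**`exists_constr`**;
fine-to-coarse correction: the level-`(n+1)` residual is lifted by `liftIter (n+1)`, which does not disturb the constraints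
of the levels `≤ n` because its support crosses into `Ω_{n+1}` while their averaging contours stay outside `Ω_{n+1}`,
`bondAvgIter_liftIter_eq_zero_of_out`).  §0 packages `Q_k`, `Q′_k` as linear maps (`bondAvgIterLin`, `siteAvgIterLin`).
-/

namespace Literature.MathematicalPhysics.QuantumFieldTheory.Balaban1983to89.B6SectAOntoV1

open LatticeFieldCalculus B5Eq118OneStroke B5Eq120IterProof B5AveragingLocalityV1 B6SectADomainsV1 B5AveragingOnto
open BalabanImbrieJaffe1984to88.BIJ85AxialPropagator411 (bondAvg_add bondAvg_smul bondAvg_zero bondAvgIter_add bondAvgIter_smul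
  bondAvgIter_map_zero)
open BalabanImbrieJaffe1984to88.BIJ85GaugeFunction5113 (siteAvgIter_add siteAvgIter_sub siteAvgIter_smul exists_blockSite_eq
  pull blk pull_apply siteAvgIter_pull)
open BalabanImbrieJaffe1984to88.BIJ85Eq5113Proof (bondAvgIter_sub)
open BalabanImbrieJaffe1984to88.BIJ85CurlQsstar (blockOf_shift_blockSite)

noncomputable section

variable {P : Params} {j : ℕ}

/-! ## §0. `Q_k`, `Q′_k` as linear maps -/

section Linear

variable {V : Type*} [AddCommGroup V] [Module ℝ V]

variable (P V) in
/-- `Q_k` (1.16)–(1.18) as a linear map. [cite: Balaban1984PropagatorsI, (1.18) p.20] -/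
def bondAvgIterLin (k : ℕ) : VecField P 0 V →ₗ[ℝ] VecField P k V where
  toFun := bondAvgIter k
  map_add' := bondAvgIter_add k
  map_smul' a A := bondAvgIter_smul k a A

variable (P V) in
/-- `Q′_k` (1.20) as a linear map. [cite: Balaban1984PropagatorsI, (1.20) p.20] -/
def siteAvgIterLin (k : ℕ) : SiteField P 0 V →ₗ[ℝ] SiteField P k V where
  toFun := siteAvgIter k
  map_add' := siteAvgIter_add k
  map_smul' := siteAvgIter_smul k

/-- unfolding `bondAvgIterLin`. [cite: Balaban1984PropagatorsI, (1.18) p.20] -/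
@[simp] theorem bondAvgIterLin_apply (k : ℕ) (A : VecField P 0 V) : bondAvgIterLin P V k A = bondAvgIter k A := rfl

/-- unfolding `siteAvgIterLin`. [cite: Balaban1984PropagatorsI, (1.20) p.20] -/
@[simp] theorem siteAvgIterLin_apply (k : ℕ) (f : SiteField P 0 V) : siteAvgIterLin P V k f = siteAvgIter k f := rfl

/-- `Q′_k` of a finite sum. [cite: Balaban1984PropagatorsI, (1.20) p.20] -/
theorem siteAvgIter_finset_sum {ι : Type*} (s : Finset ι) (k : ℕ) (f : ι → SiteField P 0 V) :
    siteAvgIter k (∑ i ∈ s, f i) = ∑ i ∈ s, siteAvgIter k (f i) :=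
  map_sum (siteAvgIterLin P V k) f s

end Linear

/-! ## §1. `Q′` maps onto the site configurations on `𝔅 = ⋃_j Λ_j` -/

/-- p08's block map `blk` is p39's `iterBlockOf`. [cite: Balaban1984PropagatorsI, (1.18) p.20] -/
theorem blk_eq_iterBlockOf : ∀ (k : ℕ) (x : Site P 0), blk k x = iterBlockOf k x
  | 0, _ => rfl
  | k + 1, x => by
    show blockOf (blk k x) = blockOf (iterBlockOf k x)
    rw [blk_eq_iterBlockOf k x]

variable (D : Domains P)

/-- the lift of the level-`j` target: the block-constant extension of `t_j·1_{Λ_j}` to `T_η`. [cite: Balaban1984PropagatorsII, (2.7) p.224] -/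
def siteLiftLam (t : (j : ℕ) → SiteField P j ℝ) (j : ℕ) : SiteField P 0 ℝ :=
  pull j fun y => if D.LamSite j y then t j y else 0

/-- `Q′_i` of the level-`j` lift at a site of `Λ_i`: the target if `i = j`, zero otherwise (the sets `B^j(Λ_j)` are pairwise
disjoint, (2.4)). [cite: Balaban1984PropagatorsII, (2.4) p.224] -/
theorem siteAvgIter_siteLiftLam (t : (j : ℕ) → SiteField P j ℝ) {i : ℕ} (hi : i ≤ P.m + P.K) (j : ℕ) (hj : j ≤ P.m + P.K)
    (y : Site P i) (hy : D.LamSite i y) :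
    siteAvgIter i (siteLiftLam D t j) y = if i = j then t i y else 0 := by
  split_ifs with hij
  · subst hij
    rw [siteLiftLam, siteAvgIter_pull i hi]
    simp [hy]
  · rw [siteAvgIter_eq_blockSum i hi, Finset.sum_eq_zero, smul_zero]
    intro x hx
    rw [mem_iterBlock] at hx
    rw [siteLiftLam, pull_apply, blk_eq_iterBlockOf]
    split_ifs with hjx
    · exact absurd (D.lamSite_iterBlockOf_unique (hx ▸ hy : D.LamSite i (iterBlockOf i x)) hjx) hij
    · rfl

/-- **`Q′` IS ONTO `L²(𝔅)` (sites)**: for every family of targets there is `λ` on `T_η` with `Q′_jλ = t_j` on `Λ_j` for every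
`j` (and `λ = t₀` on `Λ₀`) — the constraints (2.7)/(2.14) indexed by `𝔅 = ⋃_j Λ_j` are independent, so `Q′*` is injective and
`Q′G′²Q′*` is invertible for positive `G′` (p. 225). [cite: Balaban1984PropagatorsII, (2.14)–(2.17) p.225] -/
theorem exists_siteAvgIter_eq_on_lamSite (t : (j : ℕ) → SiteField P j ℝ) :
    ∃ lam : SiteField P 0 ℝ, ∀ (j : ℕ) (y : Site P j), D.LamSite j y → siteAvgIter j lam y = t j y := by
  refine ⟨∑ j ∈ Finset.range (D.k + 1), siteLiftLam D t j, fun i y hy => ?_⟩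
  have hi : i ≤ D.k := D.le_of_lamSite hy
  rw [siteAvgIter_finset_sum, Finset.sum_apply,
    Finset.sum_eq_single_of_mem i (Finset.mem_range.mpr (Nat.lt_succ_of_le hi))]
  · rw [siteAvgIter_siteLiftLam D t (hi.trans D.hk) i (hi.trans D.hk) y hy, if_pos rfl]
  · intro j hj hji
    rw [siteAvgIter_siteLiftLam D t (hi.trans D.hk) j ((Finset.mem_range_succ_iff.mp hj).trans D.hk) y hy,
      if_neg (Ne.symm hji)]

/-! ## §2. The `k`-fold far-face lift and its support -/

/-- the `k`-FOLD FAR-FACE LIFT `T^{(k)} → T^{(0)}`: the iterate of p11's one-level right inverse `bondLift` of `Q` (each step puts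
`L·B(c)` on the fine bonds crossing the far face of `B(c₋)`). [cite: Balaban1984PropagatorsI, (1.18) p.20] -/
def liftIter : (k : ℕ) → VecField P k ℝ → VecField P 0 ℝ
  | 0, B => B
  | k + 1, B => liftIter k (bondLift B)

/-- `liftIter 0 = id`. [cite: Balaban1984PropagatorsI, (1.18) p.20] -/
@[simp] theorem liftIter_zero (B : VecField P 0 ℝ) : liftIter 0 B = B := rfl

/-- `liftIter (k+1) B = liftIter k (bondLift B)`. [cite: Balaban1984PropagatorsI, (1.18) p.20] -/
theorem liftIter_succ (k : ℕ) (B : VecField P (k + 1) ℝ) : liftIter (k + 1) B = liftIter k (bondLift B) := rfl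

/-- **`Q_k ∘ liftIter k = id`** (standing range): the `k`-fold lift is a right inverse of the `k`-fold average (1.18).
[cite: Balaban1984PropagatorsI, (1.18) p.20] -/
theorem bondAvgIter_liftIter : ∀ (k : ℕ), k ≤ P.m + P.K → ∀ B : VecField P k ℝ, bondAvgIter k (liftIter k B) = B
  | 0, _, _ => rfl
  | k + 1, hk, B => by
    rw [bondAvgIter_succ, liftIter_succ, bondAvgIter_liftIter k (Nat.le_of_succ_le hk), bondAvg_bondLift hk]

/-- `bondLift 0 = 0`. [cite: Balaban1984PropagatorsI, (1.11) p.19] -/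
theorem bondLift_zero : bondLift (0 : VecField P (j + 1) ℝ) = 0 := by
  funext b; simp [bondLift]

/-- `liftIter k 0 = 0`. [cite: Balaban1984PropagatorsI, (1.18) p.20] -/
theorem liftIter_map_zero : ∀ k : ℕ, liftIter k (0 : VecField P k ℝ) = 0
  | 0 => rfl
  | k + 1 => by rw [liftIter_succ, bondLift_zero, liftIter_map_zero k]

/-- the far `μ`-face of a block: if the label of `z` is `≡ L − 1 (mod L)` in the direction `μ`, then `z + e_μ` lies in the NEXT
block `B(blockOf z + e_μ)` (standing range). [cite: Balaban1984PropagatorsI, (1.11) p.19] -/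
theorem blockOf_shift_of_face (hj : j + 1 ≤ P.m + P.K) (z : Site P j) (μ : Fin P.d) (hz : (z μ).val % P.L = P.L - 1) :
    blockOf (z.shift μ) = (blockOf z).shift μ := by
  obtain ⟨r, hr⟩ := exists_blockSite_eq hj z
  have hrμ : (r μ : ℕ) + 1 = P.L := by
    have h1 : (z μ).val = ((blockOf z) μ).val * P.L + r μ := by
      conv_lhs => rw [← hr]
      exact Site.val_blockSite hj _ r μ
    rw [h1, Nat.mul_add_mod_of_lt (r μ).isLt] at hz
    have := P.hL.2; omega
  conv_lhs => rw [← hr]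
  rw [blockOf_shift_blockSite hj, if_pos hrμ]

/-- SUPPORT OF THE `k`-FOLD LIFT: if `(liftIter k B)(b) ≠ 0` then `B ≠ 0` at the bond `⟨B^k-point of b₋, dir b⟩` of `T^{(k)}` AND
`b` CROSSES between consecutive blocks of order `k`: the block of order `k` of `b₊` is the next one (standing range).
[cite: Balaban1984PropagatorsI, (1.18) p.20] -/
theorem liftIter_support : ∀ (k : ℕ), k ≤ P.m + P.K → ∀ (B : VecField P k ℝ) (b : PBond P 0), liftIter k B b ≠ 0 →
    B ⟨iterBlockOf k b.src, b.dir⟩ ≠ 0 ∧ iterBlockOf k b.tgt = (iterBlockOf k b.src).shift b.dir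
  | 0, _, B, ⟨x, μ⟩, h => ⟨h, rfl⟩
  | k + 1, hk, B, b, h => by
    rw [liftIter_succ] at h
    obtain ⟨h1, h2⟩ := liftIter_support k (Nat.le_of_succ_le hk) (bondLift B) b h
    unfold bondLift at h1
    by_cases hface : ((iterBlockOf k b.src) b.dir).val % P.L = P.L - 1
    · rw [if_pos hface] at h1
      refine ⟨?_, ?_⟩
      · simpa [iterBlockOf_succ] using (mul_ne_zero_iff.mp h1).2
      · rw [iterBlockOf_succ, iterBlockOf_succ, h2, blockOf_shift_of_face hk _ _ hface]
    · exact absurd (by rw [if_neg hface]) h1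

/-- the fine sites over a site `z` of `T^{(i)}` avoid `Ω_{n+1}`. [cite: Balaban1984PropagatorsII, (2.2) p.224] -/
def Out (n i : ℕ) (z : Site P i) : Prop := ∀ x : Site P 0, iterBlockOf i x = z → ¬ D.InOm (n + 1) x

/-- `Out` descends to sub-blocks. [cite: Balaban1984PropagatorsII, (2.2) p.224] -/
theorem out_of_blockOf {n i : ℕ} {z : Site P i} {Y : Site P (i + 1)} (hY : Out D n (i + 1) Y) (hz : blockOf z = Y) :
    Out D n i z := fun x hx => hY x (by rw [iterBlockOf_succ, hx, hz])

/-- a `j`-block not inside `Ω_{j+1}` avoids `Ω_{n+1}` for every `n ≥ j` (nesting (2.1)). [cite: Balaban1984PropagatorsII, (2.1) p.224] -/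
theorem out_of_not_deep {n i : ℕ} (hin : i ≤ n) {z : Site P i} (hz : ¬ D.Deep i z) : Out D n i z := fun x hx =>
  D.not_inOm_of_not_deep (Nat.lt_succ_of_le hin) (by rwa [hx])

/-- CROSS-LEVEL VANISHING: the `(n+1)`-fold lift of a field supported on `Λ_{n+1}` (bonds) has zero `i`-fold average on every
`i`-bond whose end blocks avoid `Ω_{n+1}` — its support crosses INTO `Ω_{n+1}` (`liftIter_support` + the star convention of
`Λ_{n+1}`), while the averaging contours of such a bond stay inside its two end blocks (`bondAvg_eq_zero_of_local`).
[cite: Balaban1984PropagatorsII, (2.3)–(2.6) p.224] -/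
theorem bondAvgIter_liftIter_eq_zero_of_out {n : ℕ} (hn : n + 1 ≤ P.m + P.K) {r : VecField P (n + 1) ℝ}
    (hr : ∀ c : PBond P (n + 1), r c ≠ 0 → D.LamBond (n + 1) c) :
    ∀ (i : ℕ), i ≤ P.m + P.K → ∀ c : PBond P i, Out D n i c.src → Out D n i c.tgt →
      bondAvgIter i (liftIter (n + 1) r) c = 0
  | 0, _, c, hs, ht => by
    rw [bondAvgIter_zero]
    by_contra h
    obtain ⟨h1, h2⟩ := liftIter_support (n + 1) hn r c h
    have hlam := hr _ h1
    rcases hlam.1 with hm | hm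
    · exact hs c.src rfl hm
    · refine ht c.tgt rfl ?_
      show iterBlockOf (n + 1) c.tgt ∈ D.Om (n + 1)
      rwa [h2]
  | i + 1, hi, c, hs, ht => by
    rw [bondAvgIter_succ]
    refine bondAvg_eq_zero_of_local hi _ c fun b hbs hbt => ?_
    refine bondAvgIter_liftIter_eq_zero_of_out hn hr i (Nat.le_of_succ_le hi) b ?_ ?_
    · rcases hbs with h | h
      · exact out_of_blockOf D hs h
      · exact out_of_blockOf D ht h
    · rcases hbt with h | h
      · exact out_of_blockOf D hs h
      · exact out_of_blockOf D ht h

/-! ## §3. `Q` maps onto the bond configurations on `𝔅 = ⋃_j Λ_j` -/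

/-- the level-`(n+1)` residual of a field `A` against the targets `B`, restricted to `Λ_{n+1}`. [cite: Balaban1984PropagatorsII, (2.6) p.224] -/
def residual (B : (j : ℕ) → VecField P j ℝ) (A : VecField P 0 ℝ) (n : ℕ) : VecField P (n + 1) ℝ :=
  fun c => if D.LamBond (n + 1) c then B (n + 1) c - bondAvgIter (n + 1) A c else 0

/-- the residual is supported on `Λ_{n+1}`. [cite: Balaban1984PropagatorsII, (2.6) p.224] -/
theorem lamBond_of_residual_ne_zero (B : (j : ℕ) → VecField P j ℝ) (A : VecField P 0 ℝ) (n : ℕ) (c : PBond P (n + 1))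
    (h : residual D B A n c ≠ 0) : D.LamBond (n + 1) c := by
  by_contra hc
  exact h (by simp [residual, hc])

/-- FINE-TO-COARSE CONSTRUCTION of a field with prescribed multi-scale averages: `A₀ = B₀·1_{Λ₀}`,
`A_{n+1} = A_n + liftIter (n+1) (residual of A_n at level n+1)`. [cite: Balaban1984PropagatorsII, (2.6) p.224] -/
def constrLift (B : (j : ℕ) → VecField P j ℝ) : ℕ → VecField P 0 ℝ
  | 0 => fun b => if D.LamBond 0 b then B 0 b else 0
  | n + 1 => constrLift B n + liftIter (n + 1) (residual D B (constrLift B n) n)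

/-- the construction meets the constraints of all levels `≤ n` after `n` steps. [cite: Balaban1984PropagatorsII, (2.6) p.224] -/
theorem bondAvgIter_constrLift (B : (j : ℕ) → VecField P j ℝ) :
    ∀ (n i : ℕ), i ≤ n → ∀ b : PBond P i, D.LamBond i b → bondAvgIter i (constrLift D B n) b = B i b
  | 0, i, hi, b, hb => by
    obtain rfl : i = 0 := Nat.le_zero.mp hi
    simp [constrLift, bondAvgIter_zero, hb]
  | n + 1, i, hi, b, hb => by
    have hik : i ≤ P.m + P.K := (D.le_of_lamBond hb).trans D.hk
    rw [constrLift, bondAvgIter_add, Pi.add_apply]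
    rcases Nat.lt_or_eq_of_le hi with hlt | rfl
    · -- levels `i ≤ n`: the lift of the level-`(n+1)` residual does not disturb them
      rw [bondAvgIter_constrLift B n i (Nat.lt_succ_iff.mp hlt) b hb]
      by_cases hn : n + 1 ≤ P.m + P.K
      · rw [bondAvgIter_liftIter_eq_zero_of_out D hn (lamBond_of_residual_ne_zero D B _ n) i hik b
            (out_of_not_deep D (Nat.lt_succ_iff.mp hlt) hb.2.1) (out_of_not_deep D (Nat.lt_succ_iff.mp hlt) hb.2.2),
          add_zero]
      · -- beyond the standing range `Λ_{n+1} = ∅`: the residual, hence its lift, vanishes identically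
        have hres : residual D B (constrLift D B n) n = 0 := funext fun c => by
          simp [residual, D.not_lamBond_of_lt (lt_of_le_of_lt D.hk (not_le.mp hn)) c]
        rw [hres, liftIter_map_zero, bondAvgIter_map_zero, Pi.zero_apply, add_zero]
    · -- level `n + 1` itself: `Q_{n+1}` of the lift is the residual
      rw [bondAvgIter_liftIter (n + 1) hik]
      simp [residual, hb]

/-- **`Q` IS ONTO `L²(𝔅)` (bonds)**: for every family of targets `B_j` on the bond sets `Λ_j` there is a bond field `A` on `T_η`
with `A = B₀ on Λ₀, Q_jA = B_j on Λ_j, j = 1, …, k` — the constraints (2.6)/(2.20) are independent, so `Q*` is injective and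
`QGQ*` is invertible for positive `G` (p. 228: *"QGQ* is positive also and an inverse is a well-defined and positive
operator"*). [cite: Balaban1984PropagatorsII, (2.6) p.224 + (2.35) p.228] -/
theorem exists_constr (B : (j : ℕ) → VecField P j ℝ) : ∃ A : VecField P 0 ℝ, D.Constr A B :=
  ⟨constrLift D B D.k, fun j b hb => bondAvgIter_constrLift D B D.k j (D.le_of_lamBond hb) b hb⟩

end

end Literature.MathematicalPhysics.QuantumFieldTheory.Balaban1983to89.B6SectAOntoV1
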